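import Mathlib
import Summits.AnomalousDissipation.AnomalousDissipation.Theorems.DyadicWallCascadeViscousContinuationStubNoFastBlowDownPairingTools
import HarnessLib

/-!
# The blow-down of a bounded steady Navier–Stokes flow is a steady Euler flow (clause redundancy)

Crux `Summit.AnomalousDissipation.AnomalousDissipation.Theses.DyadicWallCascade.ViscousContinuation`
(stmt-AnomalousDissipation-17917, line SketchIdeator4, lead c1).  Structural by-product of the rate
obstruction `NoFastBlowDown`, addressed to the planner's re-cut of crux #3 / support #9: in the
conclusion block of `ViscousWallProfile` the EULER EQUATION of the re-quantified hierarchy `(V, Q)`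
is REDUNDANT — it follows from the Navier–Stokes clauses on `(W, P)`, the bound on `W`, the
divergence clause on `V` and the (plain, rate-free) blow-down clause.

* `blowDownEuler_weak` — the tested momentum identity `T₁(λ) + T₂(λ) = -λ⁻¹ L(λ)` of the
  rescalings (`…StubNoFastBlowDownMomentumTools`) passes to the limit `m → ∞` under plain uniform
  convergence on `tsupport φ`: `∫ V'ᵢ (Dφ·V') + ∫ Q' ∂ᵢφ = 0` (weak steady Euler);
* `blowDownEuler_strong` — for globally smooth `(V', Q')` the weak identity on an open slab gives,
  by the trilinear and pressure integration-by-parts identities of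
  `Literature/Analysis/FluidPDE/WholeSpaceIBP.lean` and the bump-function test
  (`noFastBlowDown_weyl_bump_test`), the pointwise identity
  `DV'(X)(V' X) + (div V' X) V' X + ∇Q' X = 0` on the slab;
* `blowDownEuler` — for the crux's data: `(fderiv ℝ V X) (V X) + gradient Q X = 0` on the open
  fundamental band `1 < X₂ < 2` (cut-off extensions; `div V = 0` removes the middle term), hence
  by the dilation invariance of `(V, Q)` on every open dyadic band.

The file ends with the registered stub `stub_blowDownEuler`.
-/

open MeasureTheory Set Filter Topology Function
open Literature.Analysis.FluidPDE
open scoped Laplacian RealInnerProductSpace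

set_option linter.dupNamespace false

noncomputable section

namespace Summit.AnomalousDissipation.AnomalousDissipation.Theorems

/-! ## The weak Euler identity of the blow-down limit -/

/-- **Weak steady Euler for the blow-down limit.**  Let `(W, P)` be a smooth bounded-velocity
solution of the clause-form stationary Navier–Stokes system on `ℝ³`, `V', Q'` continuous,
`φ ∈ C_c^∞`, and suppose `W (2ᵐ·) → V'`, `P (2ᵐ·) → Q'` uniformly on `tsupport φ`.  Then
`∫ V'ᵢ (Dφ·V') + ∫ Q' ∂ᵢφ = 0`: pass to the limit in `T₁(2ᵐ) + T₂(2ᵐ) = -2⁻ᵐ L(2ᵐ)`, where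
`|L| ≤ C' ∫|Δφ|`. [folklore] -/
theorem blowDownEuler_weak
    (W V' : EuclideanSpace ℝ (Fin 3) → EuclideanSpace ℝ (Fin 3)) (P Q' : EuclideanSpace ℝ (Fin 3) → ℝ)
    (C' : ℝ) (φ : EuclideanSpace ℝ (Fin 3) → ℝ) (i : Fin 3)
    (hWs : ContDiff ℝ ((⊤ : ℕ∞) : WithTop ℕ∞) W) (hPs : ContDiff ℝ ((⊤ : ℕ∞) : WithTop ℕ∞) P)
    (hWdiv : ∀ X : EuclideanSpace ℝ (Fin 3),
      ∑ i : Fin 3, (fderiv ℝ W X (EuclideanSpace.single i (1 : ℝ))) i = 0)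
    (hNS : ∀ X : EuclideanSpace ℝ (Fin 3), (fderiv ℝ W X) (W X) + gradient P X =
      ∑ i : Fin 3, fderiv ℝ (fun Y => fderiv ℝ W Y (EuclideanSpace.single i (1 : ℝ))) X
        (EuclideanSpace.single i (1 : ℝ)))
    (hWb : ∀ X, ‖W X‖ ≤ C') (hV'c : Continuous V') (hQ'c : Continuous Q')
    (hφ : ContDiff ℝ ((⊤ : ℕ∞) : WithTop ℕ∞) φ) (hφc : HasCompactSupport φ)
    (hconv : ∀ ε : ℝ, 0 < ε → ∃ M : ℕ, ∀ m : ℕ, M ≤ m → ∀ Y ∈ tsupport φ,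
      ‖W ((2 : ℝ) ^ m • Y) - V' Y‖ ≤ ε ∧ |P ((2 : ℝ) ^ m • Y) - Q' Y| ≤ ε) :
    (∫ Y, (V' Y) i * fderiv ℝ φ Y (V' Y)) +
      ∫ Y, Q' Y * fderiv ℝ φ Y (EuclideanSpace.single i (1 : ℝ)) = 0 := by
  have hWc : Continuous W := hWs.continuous
  have hPc : Continuous P := hPs.continuous
  have hφ1 : ContDiff ℝ 1 φ := contDiff_infty.1 hφ 1
  have hφ2 : ContDiff ℝ 2 φ := contDiff_infty.1 hφ 2
  have hC'0 : 0 ≤ C' := (norm_nonneg _).trans (hWb 0)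
  -- a bound for `V'` on `tsupport φ`
  obtain ⟨M₁, hM₁⟩ := hconv 1 one_pos
  have hV'b : ∀ Y ∈ tsupport φ, ‖V' Y‖ ≤ C' + 1 := by
    intro Y hY
    have h := (hM₁ M₁ le_rfl Y hY).1
    calc ‖V' Y‖ = ‖W ((2 : ℝ) ^ M₁ • Y) - (W ((2 : ℝ) ^ M₁ • Y) - V' Y)‖ := by rw [sub_sub_cancel]
      _ ≤ ‖W ((2 : ℝ) ^ M₁ • Y)‖ + ‖W ((2 : ℝ) ^ M₁ • Y) - V' Y‖ := norm_sub_le _ _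
      _ ≤ C' + 1 := add_le_add (hWb _) h
  set K1 : ℝ := ∫ Y, ‖fderiv ℝ φ Y‖ with hK1
  set K2 : ℝ := ∫ Y, |(Δ φ) Y| with hK2
  have hK10 : 0 ≤ K1 := integral_nonneg fun Y => norm_nonneg _
  have hK20 : 0 ≤ K2 := integral_nonneg fun Y => abs_nonneg _
  set T1V : ℝ := ∫ Y, (V' Y) i * fderiv ℝ φ Y (V' Y) with hT1V
  set T2V : ℝ := ∫ Y, Q' Y * fderiv ℝ φ Y (EuclideanSpace.single i (1 : ℝ)) with hT2V
  refine noFastBlowDown_eq_zero_of_abs_le (K := (C' + (C' + 1)) * K1 + K1 + 1) (by positivity) ?_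
  intro ε hε
  obtain ⟨M, hM⟩ := noFastBlowDown_exists_pow_ge (C' * K2 / ε)
  obtain ⟨M₂, hM₂⟩ := hconv ε hε
  set m : ℕ := max M M₂ with hm
  have hY := hM₂ m (le_max_right _ _)
  have hlam : (0 : ℝ) < (2 : ℝ) ^ m := by positivity
  set T1 : ℝ := ∫ Y, (W ((2 : ℝ) ^ m • Y)) i * fderiv ℝ φ Y (W ((2 : ℝ) ^ m • Y)) with hT1
  set T2 : ℝ := ∫ Y, P ((2 : ℝ) ^ m • Y) * fderiv ℝ φ Y (EuclideanSpace.single i (1 : ℝ)) with hT2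
  set L : ℝ := ∫ Y, (Δ φ) Y * (W ((2 : ℝ) ^ m • Y)) i with hL
  have hid : T1 + T2 = -(((2 : ℝ) ^ m)⁻¹ * L) :=
    noFastBlowDown_momentum_identity W P φ i hWs hPs hWdiv hNS hφ2 hφc _ hlam
  have h1 : |T1 - T1V| ≤ ε * ((C' + (C' + 1)) * K1) :=
    noFastBlowDown_momentum_convective_diff W V' φ (C' + 1) C' ε _ i hWc hV'c hφ1 hφc hWb hV'b hε.le
      (fun Y hY' => (hY Y hY').1)
  have h2 : |T2 - T2V| ≤ ε * K1 :=
    noFastBlowDown_momentum_pressure_diff P Q' φ ε _ i hPc hQ'c hφ1 hφc hε.le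
      (fun Y hY' => (hY Y hY').2)
  have h4 : |L| ≤ C' * K2 := noFastBlowDown_momentum_laplacian_bound W φ C' _ i hWc hφ2 hφc hWb
  have hL' : ((2 : ℝ) ^ m)⁻¹ * |L| ≤ ε := by
    have h := hM m (le_max_left _ _)
    calc ((2 : ℝ) ^ m)⁻¹ * |L| ≤ ((2 : ℝ) ^ m)⁻¹ * (C' * K2) :=
          mul_le_mul_of_nonneg_left h4 (by positivity)
      _ = ε * (C' * K2 / ε * ((2 : ℝ) ^ m)⁻¹) := by field_simp
      _ ≤ ε * 1 := mul_le_mul_of_nonneg_left h hε.le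
      _ = ε := mul_one ε
  have key : T1V + T2V = -(T1 - T1V) - (T2 - T2V) - ((2 : ℝ) ^ m)⁻¹ * L := by linarith [hid]
  calc |T1V + T2V| ≤ |T1 - T1V| + |T2 - T2V| + ((2 : ℝ) ^ m)⁻¹ * |L| := by
          rw [key]
          refine (abs_sub _ _).trans (add_le_add ((abs_sub _ _).trans (add_le_add ?_ le_rfl)) ?_)
          · rw [abs_neg]
          · rw [abs_mul, abs_of_pos (inv_pos.2 hlam)]
    _ ≤ ε * ((C' + (C' + 1)) * K1) + ε * K1 + ε := add_le_add (add_le_add h1 h2) hL'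
    _ = ε * ((C' + (C' + 1)) * K1 + K1 + 1) := by ring

/-! ## From the weak to the pointwise Euler identity for smooth limits -/

/-- **Weak ⇒ pointwise.**  Let `V', Q'` be smooth on `ℝ³` and suppose
`∫ V'ᵢ (Dφ·V') + ∫ Q' ∂ᵢφ = 0` for every coordinate `i` and every smooth `φ` compactly supported
in the open slab `{a < X₂ < b}`.  Then `DV'(X)(V' X) + (div V' X) • V' X + ∇Q' X = 0` on the slab:
integrate by parts (`integral_inner_convect_add_eq_zero`,
`integral_inner_gradient_eq_neg_integral_mul_divergence`) to `∫ φ Gᵢ = 0` with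
`Gᵢ = D V'ᵢ (V') + div V' · V'ᵢ + ∂ᵢ Q'`, and apply the bump-function test. [folklore] -/
theorem blowDownEuler_strong
    (V' : EuclideanSpace ℝ (Fin 3) → EuclideanSpace ℝ (Fin 3)) (Q' : EuclideanSpace ℝ (Fin 3) → ℝ)
    (a b : ℝ) (hV' : ContDiff ℝ ((⊤ : ℕ∞) : WithTop ℕ∞) V')
    (hQ' : ContDiff ℝ ((⊤ : ℕ∞) : WithTop ℕ∞) Q')
    (hweak : ∀ (φ : EuclideanSpace ℝ (Fin 3) → ℝ) (i : Fin 3),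
      ContDiff ℝ ((⊤ : ℕ∞) : WithTop ℕ∞) φ → HasCompactSupport φ →
      tsupport φ ⊆ {X : EuclideanSpace ℝ (Fin 3) | a < X 2 ∧ X 2 < b} →
      (∫ Y, (V' Y) i * fderiv ℝ φ Y (V' Y)) +
        ∫ Y, Q' Y * fderiv ℝ φ Y (EuclideanSpace.single i (1 : ℝ)) = 0)
    (X : EuclideanSpace ℝ (Fin 3)) (ha : a < X 2) (hb : X 2 < b) :
    (fderiv ℝ V' X) (V' X) + (VectorCalculus.divergence V' X) • V' X + gradient Q' X = 0 := by
  set e : Fin 3 → EuclideanSpace ℝ (Fin 3) := fun i => EuclideanSpace.single i (1 : ℝ) with he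
  have hV'1 : ContDiff ℝ 1 V' := contDiff_infty.1 hV' 1
  have hQ'1 : ContDiff ℝ 1 Q' := contDiff_infty.1 hQ' 1
  have hVi : ∀ i, ContDiff ℝ ((⊤ : ℕ∞) : WithTop ℕ∞) fun Y => (V' Y) i := fun i =>
    contDiff_euclidean.1 hV' i
  have hVi1 : ∀ i, ContDiff ℝ 1 fun Y => (V' Y) i := fun i => contDiff_infty.1 (hVi i) 1
  -- the component residual `Gᵢ`
  set G : Fin 3 → EuclideanSpace ℝ (Fin 3) → ℝ := fun i Y =>
    fderiv ℝ (fun Z => (V' Z) i) Y (V' Y) + VectorCalculus.divergence V' Y * (V' Y) i +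
      fderiv ℝ Q' Y (e i) with hG
  -- smoothness of `Gᵢ`
  have hdivs : ContDiff ℝ ((⊤ : ℕ∞) : WithTop ℕ∞) (VectorCalculus.divergence V') := by
    have : VectorCalculus.divergence V' = fun x => ∑ j, ⟪EuclideanSpace.basisFun (Fin 3) ℝ j,
        fderiv ℝ V' x (EuclideanSpace.basisFun (Fin 3) ℝ j)⟫ :=
      funext (divergence_eq_sum_inner_fderiv (EuclideanSpace.basisFun (Fin 3) ℝ) V')
    rw [this]
    exact ContDiff.sum fun j _ => contDiff_const.inner ℝ
      (noFastBlowDown_weyl_contDiff_fderiv_apply hV' _)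
  have hGs : ∀ i, ContDiff ℝ ((⊤ : ℕ∞) : WithTop ℕ∞) (G i) := by
    intro i
    refine ((((contDiff_infty_iff_fderiv.1 (hVi i)).2).clm_apply hV').add
      (hdivs.mul (hVi i))).add (noFastBlowDown_weyl_contDiff_fderiv_apply hQ' (e i))
  -- `∫ φ Gᵢ = 0` for admissible `φ`
  have hpair : ∀ i, ∀ φ : EuclideanSpace ℝ (Fin 3) → ℝ, ContDiff ℝ ((⊤ : ℕ∞) : WithTop ℕ∞) φ →
      HasCompactSupport φ → tsupport φ ⊆ {X : EuclideanSpace ℝ (Fin 3) | a < X 2 ∧ X 2 < b} →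
      ∫ Y, φ Y * G i Y = 0 := by
    intro i φ hφ hφc hsupp
    have hφ1 : ContDiff ℝ 1 φ := contDiff_infty.1 hφ 1
    have hφcn : Continuous φ := hφ1.continuous
    have hDφc : Continuous (fderiv ℝ φ) := hφ1.continuous_fderiv one_ne_zero
    have hw := hweak φ i hφ hφc hsupp
    -- the trilinear identity with `u = V'`, `v = V'ᵢ`, `w = φ`
    have tri := integral_inner_convect_add_eq_zero (F' := ℝ) hV'1 (hVi1 i) hφ1 hφc
    have e1 : ∫ x, ⟪convect V' (fun Y => (V' Y) i) x, φ x⟫ =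
        ∫ x, φ x * fderiv ℝ (fun Z => (V' Z) i) x (V' x) :=
      integral_congr_ae (Eventually.of_forall fun x => by
        simp only [convect, RCLike.inner_apply, conj_trivial])
    have e2 : ∫ x, ⟪(V' x) i, convect V' φ x⟫ = ∫ x, (V' x) i * fderiv ℝ φ x (V' x) :=
      integral_congr_ae (Eventually.of_forall fun x => by
        simp only [convect, RCLike.inner_apply, conj_trivial, mul_comm])
    have e3 : ∫ x, VectorCalculus.divergence V' x * ⟪(V' x) i, φ x⟫ =
        ∫ x, φ x * (VectorCalculus.divergence V' x * (V' x) i) :=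
      integral_congr_ae (Eventually.of_forall fun x => by
        simp only [RCLike.inner_apply, conj_trivial]; ring)
    rw [e1, e2, e3] at tri
    -- the pressure identity with `ψ = φ eᵢ`
    have hψ1 : ContDiff ℝ 1 fun Y => φ Y • e i := hφ1.smul contDiff_const
    have hψc : HasCompactSupport fun Y => φ Y • e i := hφc.smul_right (f' := fun _ => e i)
    have press := integral_inner_gradient_eq_neg_integral_mul_divergence hQ'1 hψ1 hψc
    have hdivψ : ∀ x, VectorCalculus.divergence (fun Y => φ Y • e i) x = fderiv ℝ φ x (e i) := by
      intro x
      have hd : DifferentiableAt ℝ φ x := hφ1.differentiable one_ne_zero x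
      have h1 := divergence_smul_apply (u := fun _ => e i) (θ := φ) hd (differentiableAt_const _)
      have h2 : VectorCalculus.divergence (fun _ : EuclideanSpace ℝ (Fin 3) => e i) x = 0 := by
        simp [VectorCalculus.divergence]
      rw [h1, h2, mul_zero, zero_add, gradient, real_inner_comm,
        InnerProductSpace.toDual_symm_apply]
    have e4 : ∫ x, ⟪gradient Q' x, φ x • e i⟫ = ∫ x, φ x * fderiv ℝ Q' x (e i) :=
      integral_congr_ae (Eventually.of_forall fun x => by
        show ⟪gradient Q' x, φ x • e i⟫ = φ x * fderiv ℝ Q' x (e i)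
        rw [real_inner_smul_right, gradient, InnerProductSpace.toDual_symm_apply])
    have e5 : ∫ x, Q' x * VectorCalculus.divergence (fun Y => φ Y • e i) x =
        ∫ x, Q' x * fderiv ℝ φ x (e i) :=
      integral_congr_ae (Eventually.of_forall fun x => by
        show Q' x * VectorCalculus.divergence (fun Y => φ Y • e i) x = Q' x * fderiv ℝ φ x (e i)
        rw [hdivψ])
    rw [e4, e5] at press
    -- integrability of the three pieces of `φ Gᵢ`
    have hIa : Integrable fun x => φ x * fderiv ℝ (fun Z => (V' Z) i) x (V' x) :=
      (hφcn.mul ((((hVi1 i).continuous_fderiv one_ne_zero).clm_apply hV'.continuous))).integrable_of_hasCompactSupport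
        hφc.mul_right
    have hIb : Integrable fun x => φ x * (VectorCalculus.divergence V' x * (V' x) i) :=
      (hφcn.mul (hdivs.continuous.mul (hVi i).continuous)).integrable_of_hasCompactSupport
        hφc.mul_right
    have hIc : Integrable fun x => φ x * fderiv ℝ Q' x (e i) :=
      (hφcn.mul ((hQ'1.continuous_fderiv one_ne_zero).clm_apply continuous_const)).integrable_of_hasCompactSupport
        hφc.mul_right
    have _ := hDφc
    calc ∫ Y, φ Y * G i Y
        = (∫ x, φ x * fderiv ℝ (fun Z => (V' Z) i) x (V' x)) +
            (∫ x, φ x * (VectorCalculus.divergence V' x * (V' x) i)) +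
            ∫ x, φ x * fderiv ℝ Q' x (e i) := by
          have hIab : Integrable fun x => φ x * fderiv ℝ (fun Z => (V' Z) i) x (V' x) +
              φ x * (VectorCalculus.divergence V' x * (V' x) i) := hIa.add hIb
          rw [← integral_add hIa hIb, ← integral_add hIab hIc]
          exact integral_congr_ae (Eventually.of_forall fun x => by simp only [hG]; ring)
      _ = 0 := by linarith
  -- the bump-function test, componentwise
  have hslab : IsOpen {X : EuclideanSpace ℝ (Fin 3) | a < X 2 ∧ X 2 < b} :=
    HalfSpaceHierarchy.slabExt_isOpen_band a b
  have hGX : ∀ i, G i X = 0 := fun i =>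
    noFastBlowDown_weyl_bump_test (hGs i) hslab (hpair i) (X := X) ⟨ha, hb⟩
  -- reassemble the vector identity from its components
  ext i
  have hcomp : (fderiv ℝ V' X (V' X)) i = fderiv ℝ (fun Z => (V' Z) i) X (V' X) := by
    have hd : DifferentiableAt ℝ V' X := hV'1.differentiable one_ne_zero X
    rw [show (fun Z => (V' Z) i) = (EuclideanSpace.proj i : EuclideanSpace ℝ (Fin 3) →L[ℝ] ℝ) ∘ V'
      from rfl, fderiv_comp X (EuclideanSpace.proj i).differentiableAt hd,
      ContinuousLinearMap.fderiv]
    rfl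
  have hgrad : (gradient Q' X) i = fderiv ℝ Q' X (e i) := by
    have key : ∀ v : EuclideanSpace ℝ (Fin 3), v i = ⟪v, e i⟫ := fun v => by
      simp [he, EuclideanSpace.inner_single_right]
    rw [key (gradient Q' X), gradient, InnerProductSpace.toDual_symm_apply]
  have h := hGX i
  simp only [hG] at h
  rw [PiLp.add_apply, PiLp.add_apply, PiLp.smul_apply, smul_eq_mul, hcomp, hgrad, PiLp.zero_apply]
  exact h


/-! ## The Euler clause of the blow-down hierarchy is redundant -/

/-- **The blow-down of a bounded steady Navier–Stokes flow is a steady Euler flow.**  Let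
`(W, P)` be a smooth solution on `ℝ³` of the clause-form stationary force-free Navier–Stokes system
at unit viscosity with `‖W‖ ≤ C'`, let `(V, Q)` be smooth on the open upper half-space with
`div V = 0` there, and let `(W, P)(2ᵐ·) → (V, Q)` uniformly on the band `1 ≤ X₂ ≤ 2` (the plain
blow-down clause of `ViscousWallProfile`, no rate).  Then `(V, Q)` solves the steady Euler system
on the open band: `DV(X)(V X) + ∇Q X = 0` for `1 < X₂ < 2`.  Hence the Euler clause in the
conclusion block of `ViscousWallProfile` / `ViscousContinuation` (stmt-17917) is REDUNDANT given
the other clauses (with the dilation clause it propagates to every dyadic band). [folklore] -/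
theorem blowDownEuler
    {W V : EuclideanSpace ℝ (Fin 3) → EuclideanSpace ℝ (Fin 3)} {P Q : EuclideanSpace ℝ (Fin 3) → ℝ}
    {C' : ℝ}
    (hWs : ContDiff ℝ ((⊤ : ℕ∞) : WithTop ℕ∞) W) (hPs : ContDiff ℝ ((⊤ : ℕ∞) : WithTop ℕ∞) P)
    (hWdiv : ∀ X : EuclideanSpace ℝ (Fin 3),
      ∑ i : Fin 3, (fderiv ℝ W X (EuclideanSpace.single i (1 : ℝ))) i = 0)
    (hNS : ∀ X : EuclideanSpace ℝ (Fin 3), (fderiv ℝ W X) (W X) + gradient P X =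
      ∑ i : Fin 3, fderiv ℝ (fun Y => fderiv ℝ W Y (EuclideanSpace.single i (1 : ℝ))) X
        (EuclideanSpace.single i (1 : ℝ)))
    (hWb : ∀ X, ‖W X‖ ≤ C')
    (hVs : ContDiffOn ℝ ((⊤ : ℕ∞) : WithTop ℕ∞) V {X : EuclideanSpace ℝ (Fin 3) | 0 < X 2})
    (hQs : ContDiffOn ℝ ((⊤ : ℕ∞) : WithTop ℕ∞) Q {X : EuclideanSpace ℝ (Fin 3) | 0 < X 2})
    (hVdiv : ∀ X : EuclideanSpace ℝ (Fin 3), 0 < X 2 →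
      ∑ i : Fin 3, (fderiv ℝ V X (EuclideanSpace.single i (1 : ℝ))) i = 0)
    (hbd : ∀ ε : ℝ, 0 < ε → ∃ M : ℕ, ∀ m : ℕ, M ≤ m → ∀ X : EuclideanSpace ℝ (Fin 3), 1 ≤ X 2 → X 2 ≤ 2 →
      ‖W ((2 : ℝ) ^ m • X) - V X‖ ≤ ε ∧ |P ((2 : ℝ) ^ m • X) - Q X| ≤ ε)
    (X : EuclideanSpace ℝ (Fin 3)) (h1 : 1 < X 2) (h2 : X 2 < 2) :
    (fderiv ℝ V X) (V X) + gradient Q X = 0 := by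
  set e : Fin 3 → EuclideanSpace ℝ (Fin 3) := fun i => EuclideanSpace.single i (1 : ℝ) with he
  -- ### the smooth cut-off extensions of `(V, Q)`
  obtain ⟨θ, hθs, hθ0, hθ1, -⟩ := noFastBlowDown_weyl_plateau
  set Vt : EuclideanSpace ℝ (Fin 3) → EuclideanSpace ℝ (Fin 3) := fun X => θ (X 2) • V X with hVt
  set Qt : EuclideanSpace ℝ (Fin 3) → ℝ := fun X => θ (X 2) * Q X with hQt
  have hVts : ContDiff ℝ ((⊤ : ℕ∞) : WithTop ℕ∞) Vt :=
    noFastBlowDown_weyl_cutoff_smul θ V (1 / 4) (by norm_num) hθs hθ0 hVs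
  have hQts : ContDiff ℝ ((⊤ : ℕ∞) : WithTop ℕ∞) Qt :=
    noFastBlowDown_weyl_cutoff_mul θ Q (1 / 4) (by norm_num) hθs hθ0 hQs
  have hVtV : ∀ X : EuclideanSpace ℝ (Fin 3), 1 / 2 ≤ X 2 → Vt X = V X := fun X hX => by
    simp only [hVt]; rw [hθ1 _ hX, one_smul]
  have hQtQ : ∀ X : EuclideanSpace ℝ (Fin 3), 1 / 2 ≤ X 2 → Qt X = Q X := fun X hX => by
    simp only [hQt]; rw [hθ1 _ hX, one_mul]
  -- ### the weak Euler identity on the open band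
  have hweak : ∀ (φ : EuclideanSpace ℝ (Fin 3) → ℝ) (i : Fin 3),
      ContDiff ℝ ((⊤ : ℕ∞) : WithTop ℕ∞) φ → HasCompactSupport φ →
      tsupport φ ⊆ {X : EuclideanSpace ℝ (Fin 3) | 1 < X 2 ∧ X 2 < 2} →
      (∫ Y, (Vt Y) i * fderiv ℝ φ Y (Vt Y)) +
        ∫ Y, Qt Y * fderiv ℝ φ Y (EuclideanSpace.single i (1 : ℝ)) = 0 := by
    intro φ i hφ hφc hsupp
    refine blowDownEuler_weak W Vt P Qt C' φ i hWs hPs hWdiv hNS hWb hVts.continuous hQts.continuous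
      hφ hφc fun ε hε => ?_
    obtain ⟨M, hM⟩ := hbd ε hε
    refine ⟨M, fun m hm Y hY => ?_⟩
    have hY' := hsupp hY
    rw [hVtV Y (by linarith [hY'.1]), hQtQ Y (by linarith [hY'.1])]
    exact hM m hm Y hY'.1.le hY'.2.le
  -- ### the pointwise identity for the extensions
  have hstrong := blowDownEuler_strong Vt Qt 1 2 hVts hQts hweak X h1 h2
  -- ### back to `(V, Q)`: derivatives are local, `div V = 0`
  have hslab : IsOpen {Y : EuclideanSpace ℝ (Fin 3) | 1 / 2 < Y 2 ∧ Y 2 < 3} :=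
    HalfSpaceHierarchy.slabExt_isOpen_band (1 / 2) 3
  have hmem : X ∈ {Y : EuclideanSpace ℝ (Fin 3) | 1 / 2 < Y 2 ∧ Y 2 < 3} := ⟨by linarith, by linarith⟩
  have hDV : fderiv ℝ Vt X = fderiv ℝ V X :=
    (noFastBlowDown_weyl_fderiv_congr Vt V (1 / 2) 3 (fun Y hY _ => hVtV Y hY.le) X
      (by linarith) (by linarith)).1
  have hDQ : fderiv ℝ Qt X = fderiv ℝ Q X := by
    refine Filter.EventuallyEq.fderiv_eq ?_
    filter_upwards [hslab.mem_nhds hmem] with Y hY using hQtQ Y hY.1.le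
  have hgrad : gradient Qt X = gradient Q X := by
    simp only [gradient, hDQ]
  have hdivt : VectorCalculus.divergence Vt X = 0 := by
    rw [divergence_eq_sum_inner_fderiv (EuclideanSpace.basisFun (Fin 3) ℝ), hDV]
    have hb : ∀ i, (EuclideanSpace.basisFun (Fin 3) ℝ) i = e i := fun i => by simp [he]
    simp_rw [hb]
    have hi : ∀ i, ⟪e i, fderiv ℝ V X (e i)⟫ = (fderiv ℝ V X (e i)) i := fun i => by
      simp [he, EuclideanSpace.inner_single_left]
    simp_rw [hi]
    exact hVdiv X (by linarith)
  rw [hDV, hVtV X (by linarith), hgrad, hdivt, zero_smul, add_zero] at hstrong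
  exact hstrong

/-! ## The registered stub -/

/-- **Registered stub `stub_blowDownEuler`** = `blowDownEuler` with all data explicit: the Euler
clause of the blow-down hierarchy of a bounded smooth steady Navier–Stokes flow is redundant.
[folklore] -/
theorem stub_blowDownEuler :
    ∀ (W V : EuclideanSpace ℝ (Fin 3) → EuclideanSpace ℝ (Fin 3)) (P Q : EuclideanSpace ℝ (Fin 3) → ℝ)
      (C' : ℝ), ContDiff ℝ ((⊤ : ℕ∞) : WithTop ℕ∞) W → ContDiff ℝ ((⊤ : ℕ∞) : WithTop ℕ∞) P →
      (∀ X : EuclideanSpace ℝ (Fin 3),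
        ∑ i : Fin 3, (fderiv ℝ W X (EuclideanSpace.single i (1 : ℝ))) i = 0) →
      (∀ X : EuclideanSpace ℝ (Fin 3), (fderiv ℝ W X) (W X) + gradient P X =
        ∑ i : Fin 3, fderiv ℝ (fun Y => fderiv ℝ W Y (EuclideanSpace.single i (1 : ℝ))) X
          (EuclideanSpace.single i (1 : ℝ))) →
      (∀ X, ‖W X‖ ≤ C') →
      ContDiffOn ℝ ((⊤ : ℕ∞) : WithTop ℕ∞) V {X : EuclideanSpace ℝ (Fin 3) | 0 < X 2} →
      ContDiffOn ℝ ((⊤ : ℕ∞) : WithTop ℕ∞) Q {X : EuclideanSpace ℝ (Fin 3) | 0 < X 2} →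
      (∀ X : EuclideanSpace ℝ (Fin 3), 0 < X 2 →
        ∑ i : Fin 3, (fderiv ℝ V X (EuclideanSpace.single i (1 : ℝ))) i = 0) →
      (∀ ε : ℝ, 0 < ε → ∃ M : ℕ, ∀ m : ℕ, M ≤ m → ∀ X : EuclideanSpace ℝ (Fin 3), 1 ≤ X 2 → X 2 ≤ 2 →
        ‖W ((2 : ℝ) ^ m • X) - V X‖ ≤ ε ∧ |P ((2 : ℝ) ^ m • X) - Q X| ≤ ε) →
      ∀ X : EuclideanSpace ℝ (Fin 3), 1 < X 2 → X 2 < 2 → (fderiv ℝ V X) (V X) + gradient Q X = 0 :=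
  fun _ _ _ _ _ hWs hPs hWdiv hNS hWb hVs hQs hVdiv hbd => blowDownEuler hWs hPs hWdiv hNS hWb hVs hQs hVdiv hbd

end Summit.AnomalousDissipation.AnomalousDissipation.Theorems

end
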